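import Mathlib
import HarnessLib
import Summits.NavierStokesRegularity.NavierStokesRegularity.Theorems.PoloidalWindowDoorPoloidalWindowRigidityScrewAssembly
import Summits.NavierStokesRegularity.NavierStokesRegularity.Theorems.PoloidalWindowDoorPoloidalWindowRigidityScrewKinematics
import Summits.NavierStokesRegularity.NavierStokesRegularity.Theorems.PoloidalWindowDoorPoloidalWindowRigidityScrewPressure
import Summits.NavierStokesRegularity.NavierStokesRegularity.Theorems.PoloidalWindowDoorPoloidalWindowRigidityDecayingSlopeLiouville

/-!
# Route `PoloidalWindowDoor`, crux `PoloidalWindowRigidity` (K2, stmt-NavierStokesRegularity-19708), line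
# `slicesharp-screw` — stub S1 `stub_screwStratum`: the screw-symmetric stratum of the residue is EMPTY

Cell ns-regularity-ideate, seat ns-poloidal-K2-p3 (stub-worker; registered stub of the K2 lead's skeleton
`slicesharp-screw` rev 4/6, sha16 04533a4f459e0895, signature VERBATIM; lands `--supports` the crux).

**Statement (S1, CENSUS-K2G §12 Cor. B).**  A profile of the route's Type-I class (rate, continuity on the open
slab, unit-viscosity Oseen-mild identity, divergence-free slices), poloidal along `e₃`, that is invariant on every
slice under the screw motions of some pitch `κ ≠ 0` about some vertical axis, vanishes identically.

**Proof** = the assembly `…ScrewAssembly.screwStratum_of_L2_L3_L4` (this seat, p455061: for `θ = v·h`,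
`h = e₃ + κJ(· − c)`, L3 gives the transported–diffused equation with a time-only source, L2 and the vorticity rate
`C₂/(−t)` (nsreg-p7 `…ClassRate`) give the decaying slope, L4 makes `θ` constant on slices, the kinematic identity
`∇(v·h) = h × ω` (this seat `…ScrewGlue`) makes every slice irrotational, and nsreg-p6's `…Degenerate` ends) applied to
the three LANDED support stubs: L2 `stub_screwKinematics` (ns-poloidal-K2-p1, p456307), L3 `stub_screwPressure`
(this seat), L4 `stub_decayingSlopeLiouville` (nsreg-p7, p457547; on L4a `stub_wholeSpaceComparison`, this seat,
p455923).

WHAT THIS IS NOT: not a claim about Navier–Stokes regularity and not the open residue S2 of the crux — one settled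
stratum (no continuous screw symmetry) of a door route's Type-I Liouville problem (bears_on LADDER-NS N0, rung
N0-LocalTubeDoorPoloidal).
-/

noncomputable section

-- the summit and its single sub-problem share the name (CONVENTIONS §1), as in every Theorems file
set_option linter.dupNamespace false

namespace Summit.NavierStokesRegularity.NavierStokesRegularity.Theorems.PoloidalWindowDoorPoloidalWindowRigidityScrewStratum

open scoped RealInnerProductSpace InnerProductSpace Laplacian
open Literature.Analysis Literature.Analysis.FluidPDE
open Summit.NavierStokesRegularity.NavierStokesRegularity.Theorems.PoloidalWindowDoorPoloidalWindowRigidityScrewAssembly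
open Summit.NavierStokesRegularity.NavierStokesRegularity.Theorems.PoloidalWindowDoorPoloidalWindowRigidityScrewKinematics
open Summit.NavierStokesRegularity.NavierStokesRegularity.Theorems.PoloidalWindowDoorPoloidalWindowRigidityScrewPressure
open Summit.NavierStokesRegularity.NavierStokesRegularity.Theorems.PoloidalWindowDoorPoloidalWindowRigidityDecayingSlopeLiouville

/-- **STUB S1 `stub_screwStratum` (registered signature verbatim): the screw-symmetric stratum is empty.**  A
profile of the route's Type-I class, poloidal along `e₃`, invariant on every slice under the screw motions of some
pitch `κ ≠ 0` about some vertical axis, vanishes identically — `screwStratum_of_L2_L3_L4` fed with the landed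
stubs L2, L3, L4. -/
theorem stub_screwStratum :
    ∀ (C : ℝ) (v : ℝ → EuclideanSpace ℝ (Fin 3) → EuclideanSpace ℝ (Fin 3)),
      Literature.Analysis.FluidPDE.HasTypeITimeDecay C v →
      ContinuousOn (Function.uncurry v) (Set.Iio (0 : ℝ) ×ˢ Set.univ) →
      (∀ s t : ℝ, s < t → t < 0 → ∀ x, v t x =
        Literature.Analysis.UnboundedOperators.heatExtension (v s) (t - s) x -
          Literature.Analysis.FluidPDE.oseenDuhamel 1 s v v t x) →
      (∀ t < 0, Literature.Analysis.FluidPDE.VectorCalculus.IsDivFree (v t)) →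
      (∀ s < 0, ∀ y, ⟪Literature.Analysis.FluidPDE.curl (v s) y, EuclideanSpace.single 2 1⟫_ℝ = 0) →
      (∃ κ : ℝ, κ ≠ 0 ∧ ∃ c : EuclideanSpace ℝ (Fin 3), ∀ s < 0, ∀ (a : ℝ) (y : EuclideanSpace ℝ (Fin 3)),
        v s (c + Literature.Analysis.FluidPDE.rotZ (κ * a) (y - c) + a • EuclideanSpace.single 2 (1 : ℝ)) =
          Literature.Analysis.FluidPDE.rotZ (κ * a) (v s y)) →
      ∀ t < 0, ∀ x, v t x = 0 :=
  screwStratum_of_L2_L3_L4 stub_screwKinematics stub_screwPressure stub_decayingSlopeLiouville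

/-- **S1, not backward-singular**: a profile of the screw-symmetric stratum is not backward-singular at the apex. -/
theorem not_backwardSingular_screwStratum {C : ℝ} {v : ℝ → EuclideanSpace ℝ (Fin 3) → EuclideanSpace ℝ (Fin 3)}
    (hrate : HasTypeITimeDecay C v)
    (hcont : ContinuousOn (Function.uncurry v) (Set.Iio (0 : ℝ) ×ˢ Set.univ))
    (hmild : ∀ s t : ℝ, s < t → t < 0 → ∀ x,
      v t x = UnboundedOperators.heatExtension (v s) (t - s) x - oseenDuhamel 1 s v v t x)
    (hdiv : ∀ t < 0, VectorCalculus.IsDivFree (v t))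
    (hpol : ∀ s < 0, ∀ y, ⟪curl (v s) y, EuclideanSpace.single 2 (1 : ℝ)⟫_ℝ = 0)
    (hscrew : ∃ κ : ℝ, κ ≠ 0 ∧ ∃ c : EuclideanSpace ℝ (Fin 3), ∀ s < 0, ∀ (a : ℝ) (y : EuclideanSpace ℝ (Fin 3)),
        v s (c + rotZ (κ * a) (y - c) + a • EuclideanSpace.single 2 (1 : ℝ)) = rotZ (κ * a) (v s y)) :
    ¬ IsBackwardSingularPoint v 0 :=
  not_backwardSingular_screwStratum_of_L2_L3_L4 stub_screwKinematics stub_screwPressure stub_decayingSlopeLiouville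
    hrate hcont hmild hdiv hpol hscrew

end Summit.NavierStokesRegularity.NavierStokesRegularity.Theorems.PoloidalWindowDoorPoloidalWindowRigidityScrewStratum

end
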